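import Summits.BirchSwinnertonDyer.BirchSwinnertonDyer.Theorems.AlignedTransportAtTwoMainConjectureOfRankZeroBSDAtTwoTorsionPointFieldDoors
import Summits.BirchSwinnertonDyer.BirchSwinnertonDyer.Theorems.AlignedTransportAtTwoMainConjectureOfRankZeroBSDAtTwoFineRoadCoinvCruxArch
import Summits.BirchSwinnertonDyer.BirchSwinnertonDyer.Theorems.AlignedTransportAtTwoMainConjectureOfRankZeroBSDAtTwoFineRoadCrux
import HarnessLib

/-!
# Route `AlignedTransportAtTwo`, crux C2 `MainConjectureOfRankZeroBSDAtTwo` (stmt-BirchSwinnertonDyer-22298), line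
# `birth`: stub A₂ `ClassicalMuSeedFieldsAtTwo` REDUCED to «Iwasawa's `μ₂ = 0` for ONE `2`-torsion point field
# `ℚ(P)` of every seed» — the `∃ L ⊆ ℚ(W[4])`, `[ℚ(W[4]) : L] = 2^k` clause discharged

HONEST FRAMING (cell `bsd-f1-sign2`; WIDTH-5 attached prover seat `bsd-line-att-p5` gen 2; `--supports` 22298;
closes nothing: stub A₂ and the crux item stay OPEN; BSD is proved for no curve here).  THEOREMS ONLY.  The crux-
level glue of `…TorsionPointField` (§1–§2) and `…TorsionPointFieldDoors` (§3) to the lead's registered road (b″)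
(`…FineRoadCoinvCruxArch`, skeleton `Cruxes/MainConjectureOfRankZeroBSDAtTwo/Lines/birth.lean` v4: stubs P / Lim /
K₂″ `stub_katoCoinvDataQiAtTwo` / A₂ `stub_classicalMuSeedFieldsAtTwo`) and road (b) (`…FineRoadCrux`):

* `classicalMuSeedFields_of_pointFieldMu` — the registered stub A₂ VERBATIM (its `∀ W …, ∃ L ≤ ℚ(W[4]), (∃ k, …) ∧ μ`
  body) from the point-field form «for every seed-cell curve `W` there is a non-zero `P ∈ W[2]` all of whose
  cyclotomic `ℤ₂`-extensions of `ℚ(P) = ℚ̄^{Stab(P)}` have `ClassicalMuVanishes`»: take `L = ℚ(P)`; `L ≤ ℚ(W[4])`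
  and the `2`-power index are THEOREMS (`fixedField_stabilizer_le_divisionField_four`,
  `exists_finrank_divisionField_four_eq_pow_mul_finrank_fixedField_stabilizer`).  Conversely nothing is lost:
  the cubic field `ℚ(e₁)` the planners intend IS `ℚ(P)` for `P = (e₁, …)`.
* `seedMuZeroAtTwo_of_fineRoadCoinvArch_pointFieldMu`, `mainConjectureOfRankZeroBSDAtTwo_of_fineRoadCoinvArch_pointFieldMu`
  — stub T and the crux C2 BY NAME on road (b″) from PRINT {Kato 17.4 (1)(2) at `2`, Greenberg 4.1, period unit,
  modularity, GZK, Lim 2017 Thm. 3.5 at `2`} + (K₂‴) (the lead's displayed Kato coinvariant data over `ℚ(ζ_{2^∞})`,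
  PRINT pending typing + audit) + «`μ₂(ℚ(P)) = 0` on the seed cell» (Iwasawa's conjecture for the seeds'
  `S₃`-cubic fields — OPEN class-wide; per seed two class numbers, doors in `…TorsionPointFieldDoors`).
* `mainConjectureOfRankZeroBSDAtTwo_of_fineRoad_pointFieldMu` — the same on road (b) (`…FineRoadCrux`, K₂).
* `mazurMainConjecture_two_of_bsdp_of_fineRoad_pointFieldMu` — PER CURVE: the lead's third certificate door
  `mazurMainConjecture_two_of_bsdp_of_fineRoad` with its hypothesis `hA` (statement (A) at `(W,2)`) replaced by
  `μ₂(ℚ(P)) = 0` for one non-zero `P ∈ W[2]`.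

So after this file the class-group half of road (b)/(b″) reads: A₂ ⟸ «Iwasawa `μ = 0` at `p = 2` for the cubic
`2`-torsion point fields of the seed cell» — a statement about cubic NUMBER FIELDS only, with no elliptic-curve
or division-field bookkeeping left in it.  CONDITIONAL results; nothing about any curve is asserted.

References: [Lim2017FineSelmer] §3 Thm. 3.5, Lemma 3.2; [CoatesSujatha2005] §3; [Kato2004Asterisque] Thm. 17.4,
§17.13; [GreenbergLNM1716] Conj. 1.11, Thm. 4.1; [Serre1972] §IV.
-/

noncomputable section

open scoped Classical

open Literature.NumberTheory.EllipticCurves Literature.NumberTheory.EllipticCurves.Module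

namespace Summit.BirchSwinnertonDyer.BirchSwinnertonDyer.Theorems.AlignedTransportAtTwoTorsionPointField

open CongruenceSubgroup WeierstrassCurve Field Literature.NumberTheory.EllipticCurves.ModularForms
  Literature.NumberTheory.EllipticCurves.Greenberg1999
  Literature.NumberTheory.EllipticCurves.Rank1Residual
  Literature.NumberTheory.IwasawaTheory Literature.NumberTheory.GaloisRepresentations
  Summit.BirchSwinnertonDyer.Rank1Residual Summit.BirchSwinnertonDyer.Rank1Residual.X1.MuLambda
  Summit.BirchSwinnertonDyer.Rank1Residual.X5 Summit.BirchSwinnertonDyer.Rank1Residual.F1Sign2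
  Summit.BirchSwinnertonDyer.BirchSwinnertonDyer.Theorems.Rank1ResidualX1Defs
  Summit.BirchSwinnertonDyer.BirchSwinnertonDyer.Theses.AlignedTransportAtTwo
  Summit.BirchSwinnertonDyer.BirchSwinnertonDyer.Theorems.AlignedTransportAtTwoFineRoad

/-! ## §4 Stub A₂ from the classical `μ` of ONE `2`-torsion point field per seed -/

/-- **Stub A₂ `ClassicalMuSeedFieldsAtTwo` (VERBATIM body) from the point-field form.**  If every seed-cell curve
`W` (non-CM, good ordinary at `2`, no rational point of order `2`, `Δ ∉ ℚ²`, `r_an = 0`, `BSD(W,2)`) has a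
non-zero `P ∈ W[2]` such that every cyclotomic `ℤ₂`-extension of the torsion-point field `ℚ(P) = ℚ̄^{Stab(P)}`
has Iwasawa `μ = 0` in growth form, then A₂ holds: `L := ℚ(P)` is a subfield of `ℚ(W[4])` of `2`-power index
by `fixedField_stabilizer_le_divisionField_four` / `exists_finrank_divisionField_four_eq_pow_mul_finrank_fixedField_stabilizer`.
(The seed-cell binders are passed along unused: the field theory holds for every elliptic curve.)  The
hypothesis is Iwasawa's `μ`-conjecture at `2` for the seeds' (`S₃`-)cubic fields — OPEN; nothing asserted.
[cite: Lim2017FineSelmer, §3 Thm. 3.5 (hypothesis on L)] [cite: Serre1972, §IV] -/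
theorem classicalMuSeedFields_of_pointFieldMu
    (hμ : ∀ (W : WeierstrassCurve ℚ) [W.IsElliptic] [W.IsGloballyMinimal], ¬ W.HasCM →
      IsOrdinaryAt W 2 → (∀ x : ℚ, ¬ HasRationalTwoTorsionX W x) → ¬ IsSquare W.Δ →
      W.analyticRank = 0 → BSDp W 2 →
      ∃ P : geomTorsion W 2, P ≠ 0 ∧
        ∀ κL : ZpExtension
            (IntermediateField.fixedField (MulAction.stabilizer (absoluteGaloisGroup ℚ) P)) 2,
          κL.IsCyclotomic → ClassicalMuVanishes κL) :
    ∀ (W : WeierstrassCurve ℚ) [W.IsElliptic] [W.IsGloballyMinimal], ¬ W.HasCM →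
      IsOrdinaryAt W 2 → (∀ x : ℚ, ¬ HasRationalTwoTorsionX W x) → ¬ IsSquare W.Δ →
      W.analyticRank = 0 → BSDp W 2 →
      ∃ L : IntermediateField ℚ (AlgebraicClosure ℚ), L ≤ W.divisionField 4 ∧
        (∃ k : ℕ, Module.finrank ℚ (W.divisionField 4) = 2 ^ k * Module.finrank ℚ L) ∧
        ∀ κL : ZpExtension L 2, κL.IsCyclotomic → ClassicalMuVanishes κL := by
  intro W _ _ hcm hord ht hsq hr hbsd
  obtain ⟨P, hP, hμP⟩ := hμ W hcm hord ht hsq hr hbsd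
  exact ⟨_, fixedField_stabilizer_le_divisionField_four W P,
    exists_finrank_divisionField_four_eq_pow_mul_finrank_fixedField_stabilizer W hP, hμP⟩

/-! ## §5 Stub T and the crux C2 BY NAME on road (b″) (`…FineRoadCoinvCruxArch`) with A₂ in point-field form -/

/-- **Stub T `SeedMuZeroAtTwo` on road (b″) with the class-group input in point-field form.**  Modularity
(`hmod`), Lim 2017 Thm. 3.5 at `2` (`hLim`), the lead's displayed Kato coinvariant data over `ℚ(ζ_{2^∞})` with
the archimedean balance (`hK2` = K₂‴, PRINT pending typing + the `×2` audit), and «every seed has a non-zero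
`P ∈ W[2]` with `μ₂(ℚ(P)) = 0`» (`hμ`, OPEN class-wide) ⟹ `μ₂(X(W/ℚ_∞)) = 0` on the seed cell.  CONDITIONAL.
[cite: Kato2004Asterisque, §17.13 (pp. 279–280)] [cite: Lim2017FineSelmer, §3 Thm. 3.5 and Lemma 3.2] -/
theorem seedMuZeroAtTwo_of_fineRoadCoinvArch_pointFieldMu (hmod : nonempty_modularParametrizationData)
    (hLim : Lim2017.thm35_at_two_fineSelmerDual_moduleFinite_of_classicalMuVanishes_of_le_divisionField_four)
    (hK2 : ∀ (W : WeierstrassCurve ℚ) [W.IsElliptic] [W.IsGloballyMinimal], IsOrdinaryAt W 2 →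
      (∀ x : ℚ, ¬ HasRationalTwoTorsionX W x) →
      ∀ (κ : ZpExtension ℚ 2) (γ : Field.absoluteGaloisGroup ℚ), κ.IsCyclotomic →
      κ.IsTopGenerator γ → IsCyclotomicVariable 2 γ →
      ∀ ⦃N : ℕ⦄ [NeZero N] (f : CuspForm (Gamma0 N) 2), IsNewformOf W f →
      ∀ Gp : IwasawaAlgebra 2, iwasawaToPowerSeries 2 Gp = padicLFunction f (unitRoot W 2 : ℚ_[2]) →
      ∀ (D : W.SelmerDualData κ γ) (Yd : W.FineSelmerDualData κ γ),
        ∃ (P X' Y' : Type) (_ : AddCommGroup P) (_ : _root_.Module (IwasawaAlgebra 2) P)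
          (_ : AddCommGroup X') (_ : _root_.Module (IwasawaAlgebra 2) X')
          (_ : AddCommGroup Y') (_ : _root_.Module (IwasawaAlgebra 2) Y')
          (toX : P →ₗ[IwasawaAlgebra 2] X') (π : X' →ₗ[IwasawaAlgebra 2] Y')
          (cP : P →ₗ[IwasawaAlgebra 2] P) (cX : X' →ₗ[IwasawaAlgebra 2] X')
          (cY : Y' →ₗ[IwasawaAlgebra 2] Y')
          (col : P →ₗ[IwasawaAlgebra 2] IwasawaAlgebra 2 × IwasawaAlgebra 2) (w₁ w₂ : P)
          (a b s : IwasawaAlgebra 2) (fd : (X' ⧸ LinearMap.range (cX - 1)) →ₗ[IwasawaAlgebra 2] D.X)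
          (fy : (Y' ⧸ LinearMap.range (cY - 1)) →ₗ[IwasawaAlgebra 2] Yd.X),
          Function.Exact toX π ∧ Function.Surjective π ∧ toX ∘ₗ cP = cX ∘ₗ toX ∧ π ∘ₗ cX = cY ∘ₗ π ∧
          Function.Injective col ∧
          col ∘ₗ cP = (LinearEquiv.prodComm (IwasawaAlgebra 2) (IwasawaAlgebra 2) (IwasawaAlgebra 2) :
            IwasawaAlgebra 2 × IwasawaAlgebra 2 →ₗ[IwasawaAlgebra 2]
              IwasawaAlgebra 2 × IwasawaAlgebra 2) ∘ₗ col ∧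
          Finite ((IwasawaAlgebra 2 × IwasawaAlgebra 2) ⧸ LinearMap.range col) ∧
          toX w₁ = 0 ∧ toX w₂ = 0 ∧ col w₁ = (a, b) ∧ col w₂ = (b, a) ∧
          s ∉ IwasawaAlgebra.augIdealP 2 ∧ a + b = s * Gp ∧
          Module.Finite (IwasawaAlgebra 2) X' ∧ Module.IsTorsion (IwasawaAlgebra 2) X' ∧
          Finite (D.X ⧸ LinearMap.range fd) ∧
          lengthAt (IwasawaAlgebra 2) (LinearMap.ker fy)
              ⟨IwasawaAlgebra.augIdealP 2, IwasawaAlgebra.isPrime_augIdealP_holds 2⟩ ≤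
            lengthAt (IwasawaAlgebra 2) (LinearMap.ker fd)
              ⟨IwasawaAlgebra.augIdealP 2, IwasawaAlgebra.isPrime_augIdealP_holds 2⟩)
    (hμ : ∀ (W : WeierstrassCurve ℚ) [W.IsElliptic] [W.IsGloballyMinimal], ¬ W.HasCM →
      IsOrdinaryAt W 2 → (∀ x : ℚ, ¬ HasRationalTwoTorsionX W x) → ¬ IsSquare W.Δ →
      W.analyticRank = 0 → BSDp W 2 →
      ∃ P : geomTorsion W 2, P ≠ 0 ∧
        ∀ κL : ZpExtension
            (IntermediateField.fixedField (MulAction.stabilizer (absoluteGaloisGroup ℚ) P)) 2,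
          κL.IsCyclotomic → ClassicalMuVanishes κL) :
    ∀ (W : WeierstrassCurve ℚ) [W.IsElliptic] [W.IsGloballyMinimal], ¬ W.HasCM →
      IsOrdinaryAt W 2 → (∀ x : ℚ, ¬ HasRationalTwoTorsionX W x) → ¬ IsSquare W.Δ →
      W.analyticRank = 0 →
      (∀ ⦃N : ℕ⦄ [NeZero N] (f : CuspForm (Gamma0 N) 2), IsNewformOf W f →
        ∀ G : IwasawaAlgebra 2, IsEvenBranchLiftAtTwo W f G → red G ≠ 0) →
      BSDp W 2 →
      ∀ (κ : ZpExtension ℚ 2) (γ : Field.absoluteGaloisGroup ℚ), κ.IsCyclotomic →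
        κ.IsTopGenerator γ → IsCyclotomicVariable 2 γ →
        ∀ D : W.SelmerDualData κ γ, D.IsTorsion → D.mu = 0 :=
  seedMuZeroAtTwo_of_fineRoadCoinvArch hmod hLim hK2 (classicalMuSeedFields_of_pointFieldMu hμ)

/-- **C2 `MainConjectureOfRankZeroBSDAtTwo` BY NAME on road (b″), class-group input in point-field form.**
PRINT {Kato 17.4 (1)(2) at `2` (`h17`), Greenberg 4.1 (`hGr`), the period unit at `2` (`hper`), modularity
(`hmod`), GZK (`hGZK`), Lim 2017 Thm. 3.5 at `2` (`hLim`)} + K₂‴ (`hK2`: the lead's displayed Kato coinvariant data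
over `ℚ(ζ_{2^∞})` with the archimedean balance — PRINT pending typing + audit) + «every seed-cell curve has a
non-zero `2`-torsion point `P` with Iwasawa `μ₂(ℚ(P)) = 0`» (`hμ` — OPEN: `μ = 0` at `2` for the seeds'
`S₃`-cubic fields; per seed a finite class-group computation) ⟹ C2.  CONDITIONAL: the crux item
stmt-BirchSwinnertonDyer-22298 stays open.  Compared with the lead's
`mainConjectureOfRankZeroBSDAtTwo_of_fineRoadCoinvArch`, the `∃ L ⊆ ℚ(W[4])` / `2`-power-index bookkeeping of A₂
is GONE (proved), leaving a statement about cubic number fields. [cite: Kato2004Asterisque, Thm. 17.4 (p. 273) and §17.13 (pp. 279–280)]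
[cite: Lim2017FineSelmer, §3 Thm. 3.5 and Lemma 3.2] [cite: GreenbergLNM1716, Thm. 4.1 (p. 102) and Conj. 1.11 (p. 58)] -/
theorem mainConjectureOfRankZeroBSDAtTwo_of_fineRoadCoinvArch_pointFieldMu
    (h17 : ∀ (V : WeierstrassCurve ℚ) [V.IsElliptic] [V.IsGloballyMinimal] [NeZero (V.conductorNorm ℤ)]
      (f : CuspForm (Gamma0 (V.conductorNorm ℤ)) 2), kato_divisibility_allPrimes V 2 (f := f))
    (hGr : Greenberg1999.thm41_charValue_rankZero_anyPrime)
    (hper : realPeriodRat_eq_unit_mul_plusPeriod_two) (hmod : nonempty_modularParametrizationData)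
    (hGZK : rank_eq_analyticRank_of_analyticRank_le_one)
    (hLim : Lim2017.thm35_at_two_fineSelmerDual_moduleFinite_of_classicalMuVanishes_of_le_divisionField_four)
    (hK2 : ∀ (W : WeierstrassCurve ℚ) [W.IsElliptic] [W.IsGloballyMinimal], IsOrdinaryAt W 2 →
      (∀ x : ℚ, ¬ HasRationalTwoTorsionX W x) →
      ∀ (κ : ZpExtension ℚ 2) (γ : Field.absoluteGaloisGroup ℚ), κ.IsCyclotomic →
      κ.IsTopGenerator γ → IsCyclotomicVariable 2 γ →
      ∀ ⦃N : ℕ⦄ [NeZero N] (f : CuspForm (Gamma0 N) 2), IsNewformOf W f →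
      ∀ Gp : IwasawaAlgebra 2, iwasawaToPowerSeries 2 Gp = padicLFunction f (unitRoot W 2 : ℚ_[2]) →
      ∀ (D : W.SelmerDualData κ γ) (Yd : W.FineSelmerDualData κ γ),
        ∃ (P X' Y' : Type) (_ : AddCommGroup P) (_ : _root_.Module (IwasawaAlgebra 2) P)
          (_ : AddCommGroup X') (_ : _root_.Module (IwasawaAlgebra 2) X')
          (_ : AddCommGroup Y') (_ : _root_.Module (IwasawaAlgebra 2) Y')
          (toX : P →ₗ[IwasawaAlgebra 2] X') (π : X' →ₗ[IwasawaAlgebra 2] Y')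
          (cP : P →ₗ[IwasawaAlgebra 2] P) (cX : X' →ₗ[IwasawaAlgebra 2] X')
          (cY : Y' →ₗ[IwasawaAlgebra 2] Y')
          (col : P →ₗ[IwasawaAlgebra 2] IwasawaAlgebra 2 × IwasawaAlgebra 2) (w₁ w₂ : P)
          (a b s : IwasawaAlgebra 2) (fd : (X' ⧸ LinearMap.range (cX - 1)) →ₗ[IwasawaAlgebra 2] D.X)
          (fy : (Y' ⧸ LinearMap.range (cY - 1)) →ₗ[IwasawaAlgebra 2] Yd.X),
          Function.Exact toX π ∧ Function.Surjective π ∧ toX ∘ₗ cP = cX ∘ₗ toX ∧ π ∘ₗ cX = cY ∘ₗ π ∧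
          Function.Injective col ∧
          col ∘ₗ cP = (LinearEquiv.prodComm (IwasawaAlgebra 2) (IwasawaAlgebra 2) (IwasawaAlgebra 2) :
            IwasawaAlgebra 2 × IwasawaAlgebra 2 →ₗ[IwasawaAlgebra 2]
              IwasawaAlgebra 2 × IwasawaAlgebra 2) ∘ₗ col ∧
          Finite ((IwasawaAlgebra 2 × IwasawaAlgebra 2) ⧸ LinearMap.range col) ∧
          toX w₁ = 0 ∧ toX w₂ = 0 ∧ col w₁ = (a, b) ∧ col w₂ = (b, a) ∧
          s ∉ IwasawaAlgebra.augIdealP 2 ∧ a + b = s * Gp ∧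
          Module.Finite (IwasawaAlgebra 2) X' ∧ Module.IsTorsion (IwasawaAlgebra 2) X' ∧
          Finite (D.X ⧸ LinearMap.range fd) ∧
          lengthAt (IwasawaAlgebra 2) (LinearMap.ker fy)
              ⟨IwasawaAlgebra.augIdealP 2, IwasawaAlgebra.isPrime_augIdealP_holds 2⟩ ≤
            lengthAt (IwasawaAlgebra 2) (LinearMap.ker fd)
              ⟨IwasawaAlgebra.augIdealP 2, IwasawaAlgebra.isPrime_augIdealP_holds 2⟩)
    (hμ : ∀ (W : WeierstrassCurve ℚ) [W.IsElliptic] [W.IsGloballyMinimal], ¬ W.HasCM →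
      IsOrdinaryAt W 2 → (∀ x : ℚ, ¬ HasRationalTwoTorsionX W x) → ¬ IsSquare W.Δ →
      W.analyticRank = 0 → BSDp W 2 →
      ∃ P : geomTorsion W 2, P ≠ 0 ∧
        ∀ κL : ZpExtension
            (IntermediateField.fixedField (MulAction.stabilizer (absoluteGaloisGroup ℚ) P)) 2,
          κL.IsCyclotomic → ClassicalMuVanishes κL) :
    MainConjectureOfRankZeroBSDAtTwo :=
  mainConjectureOfRankZeroBSDAtTwo_of_fineRoadCoinvArch h17 hGr hper hmod hGZK hLim hK2
    (classicalMuSeedFields_of_pointFieldMu hμ)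

/-! ## §6 Road (b) (`…FineRoadCrux`): C2 BY NAME and the per-curve certificate door, in point-field form -/

/-- **C2 BY NAME on road (b)** (`AlignedTransportAtTwoFineRoad.mainConjectureOfRankZeroBSDAtTwo_of_fineRoad`) with
the class-group input (A₂) in point-field form: PRINT + (K₂: Kato's §17.13 fine data at good ordinary `2`, a
construction TARGET) + «every seed has a non-zero `P ∈ W[2]` with `μ₂(ℚ(P)) = 0`».  CONDITIONAL.
[cite: Kato2004Asterisque, §17.13 (pp. 279–280)] [cite: Lim2017FineSelmer, §3 Thm. 3.5 and Lemma 3.2] -/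
theorem mainConjectureOfRankZeroBSDAtTwo_of_fineRoad_pointFieldMu
    (h17 : ∀ (V : WeierstrassCurve ℚ) [V.IsElliptic] [V.IsGloballyMinimal] [NeZero (V.conductorNorm ℤ)]
      (f : CuspForm (Gamma0 (V.conductorNorm ℤ)) 2), kato_divisibility_allPrimes V 2 (f := f))
    (hGr : Greenberg1999.thm41_charValue_rankZero_anyPrime)
    (hper : realPeriodRat_eq_unit_mul_plusPeriod_two) (hmod : nonempty_modularParametrizationData)
    (hGZK : rank_eq_analyticRank_of_analyticRank_le_one)
    (hLim : Lim2017.thm35_at_two_fineSelmerDual_moduleFinite_of_classicalMuVanishes_of_le_divisionField_four)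
    (hK2 : ∀ (W : WeierstrassCurve ℚ) [W.IsElliptic] [W.IsGloballyMinimal], IsOrdinaryAt W 2 →
      (∀ x : ℚ, ¬ HasRationalTwoTorsionX W x) →
      ∀ (κ : ZpExtension ℚ 2) (γ : Field.absoluteGaloisGroup ℚ), κ.IsCyclotomic →
      κ.IsTopGenerator γ → IsCyclotomicVariable 2 γ →
      ∀ ⦃N : ℕ⦄ [NeZero N] (f : CuspForm (Gamma0 N) 2), IsNewformOf W f →
      ∀ G : IwasawaAlgebra 2, iwasawaToPowerSeries 2 G = padicLFunction f (unitRoot W 2 : ℚ_[2]) →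
      ∀ (D : W.SelmerDualData κ γ) (Yd : W.FineSelmerDualData κ γ),
        ∃ (H P : Type) (_ : AddCommGroup H) (_ : _root_.Module (IwasawaAlgebra 2) H)
          (_ : AddCommGroup P) (_ : _root_.Module (IwasawaAlgebra 2) P)
          (loc : H →ₗ[IwasawaAlgebra 2] P) (toX : P →ₗ[IwasawaAlgebra 2] D.X)
          (π : D.X →ₗ[IwasawaAlgebra 2] Yd.X) (col : P →ₗ[IwasawaAlgebra 2] IwasawaAlgebra 2)
          (z : H) (s : IwasawaAlgebra 2),
          Function.Injective col ∧ (∀ h, toX (loc h) = 0) ∧ Function.Exact toX π ∧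
            s ∉ IwasawaAlgebra.augIdealP 2 ∧ col (loc z) = s * G)
    (hμ : ∀ (W : WeierstrassCurve ℚ) [W.IsElliptic] [W.IsGloballyMinimal], ¬ W.HasCM →
      IsOrdinaryAt W 2 → (∀ x : ℚ, ¬ HasRationalTwoTorsionX W x) → ¬ IsSquare W.Δ →
      W.analyticRank = 0 → BSDp W 2 →
      ∃ P : geomTorsion W 2, P ≠ 0 ∧
        ∀ κL : ZpExtension
            (IntermediateField.fixedField (MulAction.stabilizer (absoluteGaloisGroup ℚ) P)) 2,
          κL.IsCyclotomic → ClassicalMuVanishes κL) :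
    MainConjectureOfRankZeroBSDAtTwo :=
  mainConjectureOfRankZeroBSDAtTwo_of_fineRoad h17 hGr hper hmod hGZK hLim hK2
    (classicalMuSeedFields_of_pointFieldMu hμ)

/-- **THE FINE ROAD PER CURVE, class-group input in point-field form** — the lead's third certificate door
`AlignedTransportAtTwoFineRoad.mazurMainConjecture_two_of_bsdp_of_fineRoad` with its hypothesis `hA` (statement
(A) at `(W, 2)`) REPLACED by «`μ₂(ℚ(P)) = 0` for ONE non-zero `P ∈ W[2]`» (Lim 2017 at `2`, `hLim`; the numeric
Fukuda / Iwasawa-1956 versions are one `classicalMuVanishes_of_…` away, see `…TorsionPointFieldDoors`).  For a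
globally minimal `W`, good ordinary at `2`, with no rational `2`-torsion, `r_an = 0`, `BSD(W,2)`, analytic
`μ₂ = 0`, PRINT, and the displayed Kato fine data at `2` (`hK`, construction target): `MazurMainConjecture W 2`.
CONDITIONAL. [cite: Kato2004Asterisque, Thm. 17.4 (1)(2) (p. 273) and §17.13 (pp. 279–280)]
[cite: Lim2017FineSelmer, §3 Thm. 3.5 and Lemma 3.2] [cite: GreenbergLNM1716, Thm. 4.1 (p. 102)] -/
theorem mazurMainConjecture_two_of_bsdp_of_fineRoad_pointFieldMu (W : WeierstrassCurve ℚ) [W.IsElliptic]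
    [W.IsGloballyMinimal]
    (h17 : ∀ [NeZero (W.conductorNorm ℤ)] (f : CuspForm (Gamma0 (W.conductorNorm ℤ)) 2),
      kato_divisibility_allPrimes W 2 (f := f))
    (hGr : Greenberg1999.thm41_charValue_rankZero_anyPrime)
    (hper : realPeriodRat_eq_unit_mul_plusPeriod_two) (hmod : nonempty_modularParametrizationData)
    (hGZK : rank_eq_analyticRank_of_analyticRank_le_one)
    (hLim : Lim2017.thm35_at_two_fineSelmerDual_moduleFinite_of_classicalMuVanishes_of_le_divisionField_four)
    (hord : IsOrdinaryAt W 2)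
    (ht : ∀ x : ℚ, ¬ HasRationalTwoTorsionX W x) (hr : W.analyticRank = 0) (hbsd : BSDp W 2)
    (hμan : ∀ ⦃N : ℕ⦄ [NeZero N] (f : CuspForm (Gamma0 N) 2), IsNewformOf W f →
      ∀ G : IwasawaAlgebra 2, IsEvenBranchLiftAtTwo W f G → red G ≠ 0)
    (hK : ∀ (κ : ZpExtension ℚ 2) (γ : Field.absoluteGaloisGroup ℚ), κ.IsCyclotomic →
      κ.IsTopGenerator γ → IsCyclotomicVariable 2 γ →
      ∀ ⦃N : ℕ⦄ [NeZero N] (f : CuspForm (Gamma0 N) 2), IsNewformOf W f →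
      ∀ G : IwasawaAlgebra 2, iwasawaToPowerSeries 2 G = padicLFunction f (unitRoot W 2 : ℚ_[2]) →
      ∀ (D : W.SelmerDualData κ γ) (Yd : W.FineSelmerDualData κ γ),
        ∃ (H P : Type) (_ : AddCommGroup H) (_ : _root_.Module (IwasawaAlgebra 2) H)
          (_ : AddCommGroup P) (_ : _root_.Module (IwasawaAlgebra 2) P)
          (loc : H →ₗ[IwasawaAlgebra 2] P) (toX : P →ₗ[IwasawaAlgebra 2] D.X)
          (π : D.X →ₗ[IwasawaAlgebra 2] Yd.X) (col : P →ₗ[IwasawaAlgebra 2] IwasawaAlgebra 2)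
          (z : H) (s : IwasawaAlgebra 2),
          Function.Injective col ∧ (∀ h, toX (loc h) = 0) ∧ Function.Exact toX π ∧
            s ∉ IwasawaAlgebra.augIdealP 2 ∧ col (loc z) = s * G)
    {P : geomTorsion W 2} (hP : P ≠ 0)
    (hμ : ∀ κL : ZpExtension
        (IntermediateField.fixedField (MulAction.stabilizer (absoluteGaloisGroup ℚ) P)) 2,
      κL.IsCyclotomic → ClassicalMuVanishes κL) :
    MazurMainConjecture W 2 :=
  mazurMainConjecture_two_of_bsdp_of_fineRoad W h17 hGr hper hmod hGZK hord ht hr hbsd hμan hK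
    (fun κ hκ => finite_fineSelmer_twoTorsion_of_classicalMu_pointField hLim W hP hμ κ hκ)

end Summit.BirchSwinnertonDyer.BirchSwinnertonDyer.Theorems.AlignedTransportAtTwoTorsionPointField

end
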